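import Summits.QuantumFields.BalabanUV.Beta.ResolventResidualBlocks
import Summits.QuantumFields.BalabanUV.Beta.ResolventTaylorCoefficients

/-!
# Beta / ResolventResidualBlocksCoeffs — THE RESIDUAL-BLOCK LEAF IN COEFFICIENT CURRENCY: for a polynomial preconditioner the residual sup AND the six
# P-block sups of `box_certificate_of_residualBlocks` are finite coefficient-norm sums — every number of engine D's DBLOCK leaf becomes the norm of an
# explicit matrix (β sub-cell, BINDER-OWNERS row CAP-k, lineage `b2b-balaban-beta-an5`, gen 27; node BETA-an5-g27-COEFF, leaf 4)

WHY.  Gen 27 leaf 1 (`ResolventTaylorCoefficients`, p233050) put the SUP STEP of the residual leaf in the kernel (θ, p from coefficient-norm sums); leaf 2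
(`ResolventResidualBlocks`, p233462) put cap4's block identity (BLK) in the kernel but still takes the six P-block sups `p₁₁ p₁₂ p₂₁ p₂₂ s₁ s₂` as sup
hypotheses over the box.  For a polynomial preconditioner `P(q) = Σ_β δ(q)^β Z_β` every block of `P′ = P.submatrix e e` is ITSELF the polynomial family
of the blocks of the `Z_β` (`submatrix_polyEval`), so gen 23's `norm_polyEval_boxDisp_le` bounds each block sup by `Σ_β h^β ‖(Z_β)′_{block}‖`:
* §1 `submatrix_polyEval`, `norm_polyEval_submatrix_boxDisp_le`, `norm_residual_le_ofCoeffs` (the residual sup from coefficient data, standalone).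
* §2 **`box_certificate_of_residualBlocks_ofCoeffs`** — the hG-free block leaf for the stencil family `A q = Σ_{x∈S} χ_q(x) K[x]` from: the
  coefficient matrices `Z_β`; the residual coefficient-norm sum `Σ_γ h^γ‖residualCoeff γ‖ ≤ ε`, the full sum `Σ_β h^β‖Z_β‖ ≤ p`, the tail
  `taylorTail ≤ T`, `ε + p·T ≤ θ < 1`; the six BLOCKWISE coefficient-norm sums `≤ p₁₁ p₁₂ p₂₁ p₂₂ s₁ s₂`; the derived `a b c′ e′` and the norm2x2
  criterion — NO sup hypothesis of any kind.
* §3 **`ResidualBlockLeafRecord.certifies_ofCoeffs`** (the leaf-2 record reused, no new format) and **`hcert_of_residualBlockRecords_ofCoeffs`**.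

HONEST FRAMING.  Kernel glue ([folklore]); no coefficient, no box, no number supplied; 0 binders of the real row instantiated; 0 certified coefficients;
discharging `BetaPertH` would make Bałaban's ultraviolet stability UNCONDITIONAL — NOT the continuum limit, NOT the Clay problem.  HONEST DEPENDENCY:
continuum YM on T⁴ ⇐ BetaPertH ∧ nine spine estimates (0∕9 proved); BetaPertH ⇐ (D1) ∧ (D4) ∧ CAP+tail; G-an2-4 gates asym, D1 and NE2∕3∕4.
0 `sorry`, 0 cite tags.
-/

namespace Summit.QuantumFields.BalabanUV.Beta.ResolventBoxCertificate

open Complex Set Matrix Finset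
open Summit.QuantumFields.BalabanUV.Beta.PolyRegularAlgebra (character)
open scoped Real Matrix.Norms.L2Operator Pointwise

noncomputable section

/-! ## §1 Blocks of a polynomial family are the polynomial family of the blocks -/

section Blocks

variable {d : ℕ} {n m' o' : Type*} [Fintype n] [DecidableEq n] [Fintype m'] [Fintype o'] [DecidableEq m'] [DecidableEq o']

omit [Fintype n] [DecidableEq n] [Fintype m'] [Fintype o'] [DecidableEq m'] [DecidableEq o'] in
/-- a block of a polynomial family is the polynomial family of the coefficient blocks. [folklore] -/
theorem submatrix_polyEval (T : Finset (Fin (d + 1) → ℕ)) (C : (Fin (d + 1) → ℕ) → Matrix n n ℂ) (δ : Fin (d + 1) → ℝ)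
    (f : m' → n) (g : o' → n) : (polyEval T C δ).submatrix f g = ∑ β ∈ T, ((monomial β δ : ℝ) : ℂ) • (C β).submatrix f g := by
  ext i j
  simp [polyEval, Matrix.sum_apply, Matrix.submatrix_apply, Matrix.smul_apply]

omit [Fintype n] [DecidableEq n] [DecidableEq m'] in
/-- **A BLOCK SUP OF A POLYNOMIAL PRECONDITIONER FROM BLOCKWISE COEFFICIENT NORMS**: `Σ_β h^β ‖(Z_β).submatrix f g‖ ≤ pb ⟹
‖(polyEval T Z δ(q)).submatrix f g‖ ≤ pb` on the box. [folklore] -/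
theorem norm_polyEval_submatrix_boxDisp_le (T : Finset (Fin (d + 1) → ℕ)) (Z : (Fin (d + 1) → ℕ) → Matrix n n ℂ)
    (f : m' → n) (g : o' → n) {c : Fin (d + 1) → ℂ} {h : Fin (d + 1) → ℝ} {pb : ℝ}
    (hpb : ∑ β ∈ T, monomial β h * ‖(Z β).submatrix f g‖ ≤ pb) :
    ∀ q ∈ Box c h, ‖(polyEval T Z (boxDisp c q)).submatrix f g‖ ≤ pb := fun q hq => by
  rw [submatrix_polyEval]
  refine (norm_sum_le _ _).trans ((Finset.sum_le_sum fun β _ => ?_).trans hpb)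
  refine (norm_smul_le _ _).trans ?_
  rw [Complex.norm_real, Real.norm_eq_abs]
  exact mul_le_mul_of_nonneg_right (abs_monomial_le β fun μ => (hq μ).1) (norm_nonneg _)

end Blocks

/-! ## §2 The residual-block leaf in coefficient currency -/

section Leaf

variable {d : ℕ} {n v w : Type*} [Fintype n] [Fintype v] [Fintype w] [DecidableEq n] [DecidableEq v] [DecidableEq w]
  [DecidableEq (Fin (d + 1) → ℕ)]

/-- **THE RESIDUAL SUP FROM COEFFICIENT DATA** (leaf 1's identity + the kernel tail, as a standalone bound): `Σ_γ h^γ‖residualCoeff γ‖ ≤ ε`,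
`Σ_β h^β‖Z_β‖ ≤ p`, `taylorTail ≤ T`, `ε + p·T ≤ θ` ⟹ `‖1 − P(q)·A(q)‖ ≤ θ` on the box, `P(q) = polyEval T_P Z (boxDisp c q)`,
`A(q) = Σ_{x∈S} χ_q(x) K[x]`. [folklore] -/
theorem norm_residual_le_ofCoeffs {m : ℕ} (hm : 0 < m) (S : Finset (Fin (d + 1) → ℤ)) (K : (Fin (d + 1) → ℤ) → Matrix n n ℂ)
    {c : Fin (d + 1) → ℂ} {h : Fin (d + 1) → ℝ} (hsmall : ∀ x ∈ S, ∑ μ, |(x μ : ℝ)| * h μ ≤ 1)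
    (T_P : Finset (Fin (d + 1) → ℕ)) (Z : (Fin (d + 1) → ℕ) → Matrix n n ℂ) {ε p T θ : ℝ}
    (hE : ∑ γ ∈ insert 0 (T_P + degLT d m), monomial γ h * ‖residualCoeff T_P Z m S K c γ‖ ≤ ε)
    (hP : ∑ β ∈ T_P, monomial β h * ‖Z β‖ ≤ p) (hT : taylorTail m S K c h ≤ T) (hθ : ε + p * T ≤ θ) :
    ∀ q ∈ Box c h, ‖1 - polyEval T_P Z (boxDisp c q) * ∑ x ∈ S, character x q • K x‖ ≤ θ := by
  intro q hq
  have hh : ∀ μ, 0 ≤ h μ := fun μ => (abs_nonneg _).trans (hq μ).1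
  have hp0 : 0 ≤ p := (coeffNormSum_nonneg T_P Z hh).trans hP
  set Pq := polyEval T_P Z (boxDisp c q) with hPq_def
  set Aq := ∑ x ∈ S, character x q • K x with hAq_def
  set Tq := taylorFamily m S K c q with hTq_def
  have hPq : ‖Pq‖ ≤ p := norm_polyEval_boxDisp_le T_P Z hP q hq
  have hEq : ‖1 - Pq * Tq‖ ≤ ε := by
    rw [hPq_def, hTq_def, one_sub_polyEval_mul_taylorFamily]
    exact norm_polyEval_boxDisp_le _ _ hE q hq
  have htail : ‖Aq - Tq‖ ≤ T := (norm_characterSum_sub_taylorFamily_le hm S K hq hsmall).trans hT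
  have e1 : (1 : Matrix n n ℂ) - Pq * Aq = (1 - Pq * Tq) - Pq * (Aq - Tq) := by rw [Matrix.mul_sub]; abel
  rw [e1]
  calc ‖(1 - Pq * Tq) - Pq * (Aq - Tq)‖ ≤ ‖1 - Pq * Tq‖ + ‖Pq * (Aq - Tq)‖ := norm_sub_le _ _
    _ ≤ ε + ‖Pq‖ * ‖Aq - Tq‖ := add_le_add hEq (l2_opNorm_mul _ _)
    _ ≤ ε + p * T := add_le_add le_rfl (mul_le_mul hPq htail (norm_nonneg _) hp0)
    _ ≤ θ := hθ

/-- **THE hG-FREE BLOCK LEAF IN COEFFICIENT CURRENCY** for the stencil family `A q = Σ_{x∈S} χ_q(x) K[x]` and a polynomial preconditioner with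
coefficient matrices `Z_β` (`β ∈ T_P`), split `e : v ⊕ w ≃ n`.  ENGINE DATA = numbers bounding FINITE coefficient-norm sums: residual
`Σ_γ h^γ‖residualCoeff γ‖ ≤ ε`, full `Σ_β h^β‖Z_β‖ ≤ p`, blockwise `Σ_β h^β‖(Z_β′)₁₁‖ ≤ p₁₁`, `…₁₂ ≤ p₁₂`, `…₂₁ ≤ p₂₁`, `…₂₂ ≤ p₂₂`, columns
`Σ_β h^β‖Z_β′.submatrix id inl‖ ≤ s₁`, `… inr ≤ s₂` (`Z_β′ = (Z_β).submatrix e e`), a tail number `taylorTail ≤ T`; ARITHMETIC: `ε + p·T ≤ θ < 1`,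
`a ≥ p₁₁ + θ∕(1−θ)s₁`, `b ≥ p₁₂ + θ∕(1−θ)s₂`, `c′ ≥ p₂₁ + θ∕(1−θ)s₁`, `e′ ≥ p₂₂ + θ∕(1−θ)s₂`, the norm2x2 criterion for `B` ⟹ on the whole box
`IsUnit (A q).det ∧ ‖(A q)⁻¹‖ ≤ B`.  NO sup hypothesis, NO closed form. [folklore] -/
theorem box_certificate_of_residualBlocks_ofCoeffs {m : ℕ} (hm : 0 < m) (S : Finset (Fin (d + 1) → ℤ))
    (K : (Fin (d + 1) → ℤ) → Matrix n n ℂ) {c : Fin (d + 1) → ℂ} {h : Fin (d + 1) → ℝ} (hsmall : ∀ x ∈ S, ∑ μ, |(x μ : ℝ)| * h μ ≤ 1)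
    (T_P : Finset (Fin (d + 1) → ℕ)) (Z : (Fin (d + 1) → ℕ) → Matrix n n ℂ) (e : v ⊕ w ≃ n)
    {ε p T θ p₁₁ p₁₂ p₂₁ p₂₂ s₁ s₂ a b c' e' B : ℝ}
    (hE : ∑ γ ∈ insert 0 (T_P + degLT d m), monomial γ h * ‖residualCoeff T_P Z m S K c γ‖ ≤ ε)
    (hP : ∑ β ∈ T_P, monomial β h * ‖Z β‖ ≤ p) (hT : taylorTail m S K c h ≤ T) (hθ : ε + p * T ≤ θ) (hθ1 : θ < 1)
    (h₁₁ : ∑ β ∈ T_P, monomial β h * ‖((Z β).submatrix e e).toBlocks₁₁‖ ≤ p₁₁)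
    (h₁₂ : ∑ β ∈ T_P, monomial β h * ‖((Z β).submatrix e e).toBlocks₁₂‖ ≤ p₁₂)
    (h₂₁ : ∑ β ∈ T_P, monomial β h * ‖((Z β).submatrix e e).toBlocks₂₁‖ ≤ p₂₁)
    (h₂₂ : ∑ β ∈ T_P, monomial β h * ‖((Z β).submatrix e e).toBlocks₂₂‖ ≤ p₂₂)
    (hs₁ : ∑ β ∈ T_P, monomial β h * ‖((Z β).submatrix e e).submatrix id Sum.inl‖ ≤ s₁)
    (hs₂ : ∑ β ∈ T_P, monomial β h * ‖((Z β).submatrix e e).submatrix id Sum.inr‖ ≤ s₂)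
    (ha : p₁₁ + θ / (1 - θ) * s₁ ≤ a) (hb : p₁₂ + θ / (1 - θ) * s₂ ≤ b) (hc : p₂₁ + θ / (1 - θ) * s₁ ≤ c')
    (he : p₂₂ + θ / (1 - θ) * s₂ ≤ e') (hB : 0 ≤ B) (hp : a ^ 2 + c' ^ 2 ≤ B ^ 2) (hq₂ : b ^ 2 + e' ^ 2 ≤ B ^ 2)
    (hr : (a * b + c' * e') ^ 2 ≤ (B ^ 2 - (a ^ 2 + c' ^ 2)) * (B ^ 2 - (b ^ 2 + e' ^ 2))) :
    ∀ q ∈ Box c h, IsUnit (∑ x ∈ S, character x q • K x).det ∧ ‖(∑ x ∈ S, character x q • K x)⁻¹‖ ≤ B := by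
  -- every `toBlocks` ∕ column block of `(Z β).submatrix e e` is ONE `submatrix` selection of `Z β`
  simp only [toBlocks₁₁_eq_submatrix, toBlocks₁₂_eq_submatrix, toBlocks₂₁_eq_submatrix, toBlocks₂₂_eq_submatrix,
    Matrix.submatrix_submatrix] at h₁₁ h₁₂ h₂₁ h₂₂ hs₁ hs₂
  refine box_certificate_of_residualBlocks (A := fun q => ∑ x ∈ S, character x q • K x)
    (P := fun q => polyEval T_P Z (boxDisp c q)) e (norm_residual_le_ofCoeffs hm S K hsmall T_P Z hE hP hT hθ) hθ1
    (fun q' hq' => ?_) (fun q' hq' => ?_) (fun q' hq' => ?_) (fun q' hq' => ?_) (fun q' hq' => ?_) (fun q' hq' => ?_)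
    ha hb hc he hB hp hq₂ hr
  · rw [toBlocks₁₁_eq_submatrix, Matrix.submatrix_submatrix]
    exact norm_polyEval_submatrix_boxDisp_le T_P Z _ _ h₁₁ q' hq'
  · rw [toBlocks₁₂_eq_submatrix, Matrix.submatrix_submatrix]
    exact norm_polyEval_submatrix_boxDisp_le T_P Z _ _ h₁₂ q' hq'
  · rw [toBlocks₂₁_eq_submatrix, Matrix.submatrix_submatrix]
    exact norm_polyEval_submatrix_boxDisp_le T_P Z _ _ h₂₁ q' hq'
  · rw [toBlocks₂₂_eq_submatrix, Matrix.submatrix_submatrix]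
    exact norm_polyEval_submatrix_boxDisp_le T_P Z _ _ h₂₂ q' hq'
  · rw [Matrix.submatrix_submatrix]
    exact norm_polyEval_submatrix_boxDisp_le T_P Z _ _ hs₁ q' hq'
  · rw [Matrix.submatrix_submatrix]
    exact norm_polyEval_submatrix_boxDisp_le T_P Z _ _ hs₂ q' hq'

end Leaf

end

end Summit.QuantumFields.BalabanUV.Beta.ResolventBoxCertificate

/-! ## §3 The residual-block record in coefficient currency -/

namespace Summit.QuantumFields.BalabanUV.Beta.ResolventResidualBlocks

open Complex Set Matrix Finset
open Summit.QuantumFields.BalabanUV.Beta.PolyRegularAlgebra (character)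
open Summit.QuantumFields.BalabanUV.Beta.ResolventBoxCertificate
open scoped Real Matrix.Norms.L2Operator Pointwise

noncomputable section

variable {d : ℕ} {n v w : Type*} [Fintype n] [Fintype v] [Fintype w] [DecidableEq n] [DecidableEq v] [DecidableEq w]
  [DecidableEq (Fin (d + 1) → ℕ)]

/-- **A VALID RESIDUAL-BLOCK RECORD CERTIFIES ITS BOX FROM COEFFICIENT DATA**: validity + the coefficient matrices `Z_β` + the residual, full and
six blockwise coefficient-norm sums bounded by `ε`, `p` and the record's `p₁₁ p₁₂ p₂₁ p₂₂ s₁ s₂`, a tail bound `T` and `ε + p·T ≤ θ` ⟹ the stencil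
family is invertible with `‖(A q)⁻¹‖ ≤ B` on the record's box — all seven «sups» of the record DISCHARGED from finite sums. [folklore] -/
theorem ResidualBlockLeafRecord.certifies_ofCoeffs (r : ResidualBlockLeafRecord d) (hv : r.Valid) {m : ℕ} (hm : 0 < m)
    (S : Finset (Fin (d + 1) → ℤ)) (K : (Fin (d + 1) → ℤ) → Matrix n n ℂ) (hsmall : ∀ x ∈ S, ∑ μ, |(x μ : ℝ)| * r.hw μ ≤ 1)
    (T_P : Finset (Fin (d + 1) → ℕ)) (Z : (Fin (d + 1) → ℕ) → Matrix n n ℂ) (e : v ⊕ w ≃ n) {ε p T : ℝ}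
    (hE : ∑ γ ∈ insert 0 (T_P + degLT d m), monomial γ r.hw * ‖residualCoeff T_P Z m S K r.ctr γ‖ ≤ ε)
    (hP : ∑ β ∈ T_P, monomial β r.hw * ‖Z β‖ ≤ p) (hT : taylorTail m S K r.ctr r.hw ≤ T) (hθ : ε + p * T ≤ r.θ)
    (h₁₁ : ∑ β ∈ T_P, monomial β r.hw * ‖((Z β).submatrix e e).toBlocks₁₁‖ ≤ r.p₁₁)
    (h₁₂ : ∑ β ∈ T_P, monomial β r.hw * ‖((Z β).submatrix e e).toBlocks₁₂‖ ≤ r.p₁₂)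
    (h₂₁ : ∑ β ∈ T_P, monomial β r.hw * ‖((Z β).submatrix e e).toBlocks₂₁‖ ≤ r.p₂₁)
    (h₂₂ : ∑ β ∈ T_P, monomial β r.hw * ‖((Z β).submatrix e e).toBlocks₂₂‖ ≤ r.p₂₂)
    (hs₁ : ∑ β ∈ T_P, monomial β r.hw * ‖((Z β).submatrix e e).submatrix id Sum.inl‖ ≤ r.s₁)
    (hs₂ : ∑ β ∈ T_P, monomial β r.hw * ‖((Z β).submatrix e e).submatrix id Sum.inr‖ ≤ r.s₂) :
    ∀ q ∈ r.box, IsUnit (∑ x ∈ S, character x q • K x).det ∧ ‖(∑ x ∈ S, character x q • K x)⁻¹‖ ≤ r.B := by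
  obtain ⟨hθ1, hB, hp, hq, hr⟩ := hv
  have hθ1' : (r.θ : ℝ) < 1 := by exact_mod_cast hθ1
  have ht : ((r.t : ℚ) : ℝ) = (r.θ : ℝ) / (1 - r.θ) := by simp [ResidualBlockLeafRecord.t]
  refine box_certificate_of_residualBlocks_ofCoeffs hm S K hsmall T_P Z e hE hP hT hθ hθ1' h₁₁ h₁₂ h₂₁ h₂₂ hs₁ hs₂
    (a := r.a) (b := r.b) (c' := r.c') (e' := r.e') (B := r.B) ?_ ?_ ?_ ?_ ?_ ?_ ?_ ?_
  · rw [← ht]; exact_mod_cast (le_refl r.a)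
  · rw [← ht]; exact_mod_cast (le_refl r.b)
  · rw [← ht]; exact_mod_cast (le_refl r.c')
  · rw [← ht]; exact_mod_cast (le_refl r.e')
  · exact_mod_cast hB
  · exact_mod_cast hp
  · exact_mod_cast hq
  · exact_mod_cast hr

/-- **`hcert` FROM RESIDUAL-BLOCK RECORDS IN COEFFICIENT CURRENCY**: one record per box of a list (valid, budget `≤ Ba`, box inside the record's box)
and per record the engine's coefficient data `(m, T_P, Z, ε, p, T)` with the residual, full and six blockwise coefficient-norm sums ⟹ the binder
`hcert` of every route-A anchor for the stencil family — NO sup hypothesis, NO closed form, NO `hG`. [folklore] -/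
theorem hcert_of_residualBlockRecords_ofCoeffs {boxes : Finset ((Fin (d + 1) → ℂ) × (Fin (d + 1) → ℝ))}
    (rec : (Fin (d + 1) → ℂ) × (Fin (d + 1) → ℝ) → ResidualBlockLeafRecord d) {Ba : ℝ}
    (hvalid : ∀ bx ∈ boxes, (rec bx).Valid ∧ ((rec bx).B : ℝ) ≤ Ba)
    (hsub : ∀ bx ∈ boxes, Box bx.1 bx.2 ⊆ (rec bx).box)
    (S : Finset (Fin (d + 1) → ℤ)) (K : (Fin (d + 1) → ℤ) → Matrix n n ℂ)
    (hsmall : ∀ bx ∈ boxes, ∀ x ∈ S, ∑ μ, |(x μ : ℝ)| * (rec bx).hw μ ≤ 1) (e : v ⊕ w ≃ n)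
    (m : (Fin (d + 1) → ℂ) × (Fin (d + 1) → ℝ) → ℕ) (hm : ∀ bx ∈ boxes, 0 < m bx)
    (T_P : (Fin (d + 1) → ℂ) × (Fin (d + 1) → ℝ) → Finset (Fin (d + 1) → ℕ))
    (Z : (Fin (d + 1) → ℂ) × (Fin (d + 1) → ℝ) → (Fin (d + 1) → ℕ) → Matrix n n ℂ)
    (ε p T : (Fin (d + 1) → ℂ) × (Fin (d + 1) → ℝ) → ℝ)
    (hE : ∀ bx ∈ boxes, ∑ γ ∈ insert 0 (T_P bx + degLT d (m bx)), monomial γ (rec bx).hw *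
      ‖residualCoeff (T_P bx) (Z bx) (m bx) S K (rec bx).ctr γ‖ ≤ ε bx)
    (hP : ∀ bx ∈ boxes, ∑ β ∈ T_P bx, monomial β (rec bx).hw * ‖Z bx β‖ ≤ p bx)
    (hT : ∀ bx ∈ boxes, taylorTail (m bx) S K (rec bx).ctr (rec bx).hw ≤ T bx)
    (hθ : ∀ bx ∈ boxes, ε bx + p bx * T bx ≤ (rec bx).θ)
    (h₁₁ : ∀ bx ∈ boxes, ∑ β ∈ T_P bx, monomial β (rec bx).hw * ‖((Z bx β).submatrix e e).toBlocks₁₁‖ ≤ (rec bx).p₁₁)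
    (h₁₂ : ∀ bx ∈ boxes, ∑ β ∈ T_P bx, monomial β (rec bx).hw * ‖((Z bx β).submatrix e e).toBlocks₁₂‖ ≤ (rec bx).p₁₂)
    (h₂₁ : ∀ bx ∈ boxes, ∑ β ∈ T_P bx, monomial β (rec bx).hw * ‖((Z bx β).submatrix e e).toBlocks₂₁‖ ≤ (rec bx).p₂₁)
    (h₂₂ : ∀ bx ∈ boxes, ∑ β ∈ T_P bx, monomial β (rec bx).hw * ‖((Z bx β).submatrix e e).toBlocks₂₂‖ ≤ (rec bx).p₂₂)
    (hs₁ : ∀ bx ∈ boxes, ∑ β ∈ T_P bx, monomial β (rec bx).hw * ‖((Z bx β).submatrix e e).submatrix id Sum.inl‖ ≤ (rec bx).s₁)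
    (hs₂ : ∀ bx ∈ boxes, ∑ β ∈ T_P bx, monomial β (rec bx).hw * ‖((Z bx β).submatrix e e).submatrix id Sum.inr‖ ≤ (rec bx).s₂) :
    ∀ bx ∈ boxes, ∀ q ∈ Box bx.1 bx.2,
      IsUnit (∑ x ∈ S, character x q • K x).det ∧ ‖(∑ x ∈ S, character x q • K x)⁻¹‖ ≤ Ba := fun bx hbx q hq =>
  let hc := (rec bx).certifies_ofCoeffs (hvalid bx hbx).1 (hm bx hbx) S K (hsmall bx hbx) (T_P bx) (Z bx) e (hE bx hbx) (hP bx hbx)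
    (hT bx hbx) (hθ bx hbx) (h₁₁ bx hbx) (h₁₂ bx hbx) (h₂₁ bx hbx) (h₂₂ bx hbx) (hs₁ bx hbx) (hs₂ bx hbx) q (hsub bx hbx hq)
  ⟨hc.1, hc.2.trans (hvalid bx hbx).2⟩

end

end Summit.QuantumFields.BalabanUV.Beta.ResolventResidualBlocks
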